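import Summits.Ventures.Crystal3D.Theorems.StickyWulffConstantGenericWallFloorBarlowHRowFamily
import Summits.Ventures.Crystal3D.Theorems.StickyWulffConstantGenericWallFloorHRowEndFarApartDefs
import Summits.Ventures.Crystal3D.Theorems.StickyWulffConstantGenericWallFloorHRowNoBottomState
import HarnessLib

/-!
# The h-LAYER ROW MEMBERS, repaired form: an h-row END carries no certified BOTTOM state ((J-a)) and — under `HRowEndFarApart κ` — no rising
# certified state APART from the plate lattice and its basal twin (crux `GenericWallFloor`, stmt-Ventures-19480, kernel G; LAYER ROWS step (ii)′
# after `not_hRowEndFar` p724034; machine owner 19480-p2 g14; sequel of `…BarlowHRowFamily` p720030, `…HRowEndFarApartDefs` p724742)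

HONEST FRAMING. Venture `Summits/Ventures/Crystal3D` (cell `crystal3d-full`), route `route-Ventures-StickyWulffConstant`, helper for the crux
`GenericWallFloor` (stmt-Ventures-19480) / consumer `TextureLiminfV5` (stmt-Ventures-23912).  `hRow_member_core/A/B` of `…BarlowHRowFamily`
VERBATIM except for the last conclusion: the refuted blanket exclusion (`HRowEndFar`) is replaced by (1) the UNCONDITIONAL exclusion of the two
c-grain BOTTOM states `⟨L₁, u, 0⟩`, `⟨twinFrame L₁ (L₁ e₃), u, 0⟩` at the h-row end (`not_walkCertified_bottom_of_hFull`, (J-a): the predecessor is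
h-full) and (2) the exclusion of rising strongly certified states whose frame lattice is APART from `L₁·Λ₀` and its basal twin, from the repaired
named input `HRowEndFarApart κ` with `κ ≤ (L₁ u)₂`.  Named inputs BY NAME: `HStarModel` (E1h) and `HRowEndFarApart κ` ((J-b′)); standard axioms;
F-C1 not moved; NOT R1′.
* `basalMirror_mem_hcpSlots`, `hFull_twinFrame` — the h-dozen is basal-mirror closed, so an h-full predecessor is h-full in the basal twin frame too;
* `not_walkCertified12_bottoms_of_hRowInv` — (J-a) for both c-grain bottoms at a ball with `HRowInv`;
* `walkCertified12_negTrans_iff`, `twinFrame_negTrans_axis` — the type-B presentation `(neg ≫ L, −u)` certifies exactly what `(L, u)` does;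
* **`hRow_member_core_apart`**, **`hRow_member_A_apart`**, **`hRow_member_B_apart`**.
-/

noncomputable section

namespace Summit.Ventures.Crystal3D.Theorems

open Finset
open Literature.MathematicalPhysics.StatisticalMechanics
open Summit.Ventures.Crystal3D.Cruxes.TextureLiminf.TexShadow (stacking bestLayerDir)
open scoped InnerProductSpace

variable {X : Finset (EuclideanSpace ℝ (Fin 3))}

/-! ### The h-dozen in the basal twin frame; bottom exclusion -/

/-- The h-dozen is closed under the basal mirror. -/
theorem basalMirror_mem_hcpSlots {s : EuclideanSpace ℝ (Fin 3)} (hs : s ∈ hcpSlots) : basalMirror s ∈ hcpSlots := by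
  rcases mem_hcpSlots.1 hs with ⟨hs', hs2⟩ | ⟨t, ⟨ht, ht2⟩, rfl⟩
  · exact basalMirror_mem_hcpSlots_of_upper hs' hs2
  · rw [basalMirror_basalMirror]; exact mem_hcpSlots_of_upper ht ht2

/-- **An h-full predecessor is h-full in the basal twin frame** (`twinFrame F (F e₃) = F ∘ basalMirror`, the direction is in-plane). -/
theorem hFull_twinFrame {F : EuclideanSpace ℝ (Fin 3) ≃ₗᵢ[ℝ] EuclideanSpace ℝ (Fin 3)} {v y : EuclideanSpace ℝ (Fin 3)} (hv2 : v 2 = 0)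
    (hfull : ∀ s ∈ hcpSlots, y - F v + F s ∈ X) :
    ∀ s ∈ hcpSlots, y - (twinFrame F (F (EuclideanSpace.single (2 : Fin 3) (1 : ℝ)))) v +
      (twinFrame F (F (EuclideanSpace.single (2 : Fin 3) (1 : ℝ)))) s ∈ X := by
  intro s hs
  rw [twinFrame_axis_apply, twinFrame_axis_apply, basalMirror_of_inPlane hv2]
  exact hfull _ (basalMirror_mem_hcpSlots hs)

/-- **(J-a) for both c-grain bottoms.**  At a ball with `HRowInv X F v y` (predecessor `y − F v` h-full, `v` an in-plane slot) neither `⟨F, v, 0⟩` nor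
`⟨twinFrame F (F e₃), v, 0⟩` is strongly certified. -/
theorem not_walkCertified12_bottoms_of_hRowInv (hX : ∀ p ∈ X, ∀ q ∈ X, p ≠ q → 1 ≤ dist p q)
    {F : EuclideanSpace ℝ (Fin 3) ≃ₗᵢ[ℝ] EuclideanSpace ℝ (Fin 3)} {v y : EuclideanSpace ℝ (Fin 3)} (hv : v ∈ fccSlots) (hv2 : v 2 = 0)
    (hI : HRowInv X F v y) :
    ¬ WalkCertified12 X y ⟨F, v, 0⟩ ∧ ¬ WalkCertified12 X y ⟨twinFrame F (F (EuclideanSpace.single (2 : Fin 3) (1 : ℝ))), v, 0⟩ :=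
  ⟨fun h => not_walkCertified_bottom_of_hFull hX hv hv2 hI.2.2 rfl rfl h.walkCertified,
    fun h => not_walkCertified_bottom_of_hFull hX hv hv2 (hFull_twinFrame hv2 hI.2.2) rfl rfl h.walkCertified⟩

/-! ### The type-B presentation certifies what the c-grain presentation does -/

/-- `twinFrame (neg ≫ L) ((neg ≫ L) e₃) = neg ≫ twinFrame L (L e₃)`. -/
theorem twinFrame_negTrans_axis (L : EuclideanSpace ℝ (Fin 3) ≃ₗᵢ[ℝ] EuclideanSpace ℝ (Fin 3)) :
    twinFrame ((LinearIsometryEquiv.neg ℝ).trans L) (((LinearIsometryEquiv.neg ℝ).trans L) (EuclideanSpace.single (2 : Fin 3) (1 : ℝ))) =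
      (LinearIsometryEquiv.neg ℝ).trans (twinFrame L (L (EuclideanSpace.single (2 : Fin 3) (1 : ℝ)))) := by
  have he : ‖(EuclideanSpace.single (2 : Fin 3) (1 : ℝ))‖ = 1 := by rw [PiLp.norm_single, norm_one]
  have hLe : ‖L (EuclideanSpace.single (2 : Fin 3) (1 : ℝ))‖ = 1 := by rw [LinearIsometryEquiv.norm_map, he]
  have hNe : ‖((LinearIsometryEquiv.neg ℝ).trans L) (EuclideanSpace.single (2 : Fin 3) (1 : ℝ))‖ = 1 := by
    rw [LinearIsometryEquiv.norm_map, he]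
  have hN : ∀ y : EuclideanSpace ℝ (Fin 3), ((LinearIsometryEquiv.neg ℝ).trans L) y = -L y := fun y => by
    show L (-y) = -L y; rw [map_neg]
  refine LinearIsometryEquiv.ext fun x => ?_
  show twinFrame _ _ x = twinFrame L (L (EuclideanSpace.single (2 : Fin 3) (1 : ℝ))) (-x)
  rw [twinFrame_apply _ hNe, twinFrame_apply _ hLe, hN, hN, map_neg, inner_neg_left, inner_neg_right, neg_neg, smul_neg, inner_neg_left,
    mul_neg, neg_smul]

/-- **`(neg ≫ L, −u)` certifies exactly what `(L, u)` does**: same predecessor, same slot dozen, same menus. -/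
theorem walkCertified12_negTrans_iff (X : Finset (EuclideanSpace ℝ (Fin 3))) (L : EuclideanSpace ℝ (Fin 3) ≃ₗᵢ[ℝ] EuclideanSpace ℝ (Fin 3))
    (u y : EuclideanSpace ℝ (Fin 3)) :
    WalkCertified12 X y ⟨(LinearIsometryEquiv.neg ℝ).trans L, -u, 0⟩ ↔ WalkCertified12 X y ⟨L, u, 0⟩ := by
  have hN : ∀ x : EuclideanSpace ℝ (Fin 3), ((LinearIsometryEquiv.neg ℝ).trans L) x = L (-x) := fun x => rfl
  have hdir : ((LinearIsometryEquiv.neg ℝ).trans L) (-u) = L u := by rw [hN, neg_neg]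
  have reidx : ∀ (P : EuclideanSpace ℝ (Fin 3) → Prop), (∀ w ∈ fccSlots, P (L (-w))) ↔ (∀ w ∈ fccSlots, P (L w)) := by
    intro P
    constructor
    · intro h w hw; have := h (-w) (neg_mem_fccSlots hw); rwa [neg_neg] at this
    · intro h w hw; exact h (-w) (neg_mem_fccSlots hw)
  unfold WalkCertified12 CapCertified
  simp only [hN, neg_neg]
  refine or_congr ?_ (exists_congr fun n₀ => ?_)
  · exact and_congr Iff.rfl (reidx fun x => y - L u + x ∈ X)
  · refine and_congr Iff.rfl (and_congr ?_ (and_congr Iff.rfl (and_congr Iff.rfl (and_congr ?_ ?_))))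
    · exact reidx fun x => ⟪x, n₀⟫_ℝ = 0 ∨ ⟪x, n₀⟫_ℝ = Real.sqrt (2 / 3) ∨ ⟪x, n₀⟫_ℝ = -Real.sqrt (2 / 3)
    · exact reidx fun x => 0 ≤ ⟪x, n₀⟫_ℝ → y - L u + x ∈ X
    · exact reidx fun x => 0 < ⟪x, n₀⟫_ℝ → y - L u + x - (2 * Real.sqrt (2 / 3)) • n₀ ∈ X

/-! ### The members -/

section Cell

variable (σ₁ : ℤ → ℤ) (L₁ : EuclideanSpace ℝ (Fin 3) ≃ₗᵢ[ℝ] EuclideanSpace ℝ (Fin 3)) (s₀ : EuclideanSpace ℝ (Fin 3))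

/-- The common core of the two member lemmas: an h-row run in the frame `F` along `v` (`F v = L₁ u`, rise `≥ 3/4`), started at
`y₀ = L₁ (barlowPos σ₁ k a b) + s₀` with `HRowInv`, `y₀` in the launch band and laterally inside: the END is `y₀ + n·F v`, lies in `PAY`, the walk
has stopped there with `HRowInv`, it carries NO certified BOTTOM state `⟨F, v, 0⟩` / `⟨twinFrame F (F e₃), v, 0⟩` ((J-a)), and under `HRowEndFarApart κ`
(`κ ≤ (F v)₂`) no rising strongly certified state APART from `F·Λ₀` and its basal twin sits there. -/
theorem hRow_member_core_apart (hX : ∀ p ∈ X, ∀ q ∈ X, p ≠ q → 1 ≤ dist p q) (hσ₁ : IsHaggSeq σ₁)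
    (hModel : HStarModel) {κ : ℝ} (hJ : HRowEndFarApart κ)
    {σ₂ : ℤ → ℤ} (hσ₂ : IsHaggSeq σ₂) (L₂ : EuclideanSpace ℝ (Fin 3) ≃ₗᵢ[ℝ] EuclideanSpace ℝ (Fin 3)) (s₂ : EuclideanSpace ℝ (Fin 3))
    (R₀ h ρ : ℝ) (hR₀ : 4 ≤ R₀) (hh : 0 ≤ h) (P₁ P₂ : Finset (EuclideanSpace ℝ (Fin 3))) (hP₁X : P₁ ⊆ X) (hP₂X : P₂ ⊆ X)
    (hcell : ∀ p ∈ X, -(2 * R₀) ≤ p 2 ∧ p 2 ≤ h + 2 * R₀ ∧ p 0 ^ 2 + p 1 ^ 2 ≤ ρ ^ 2)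
    (hP₁ : ∀ p, p ∈ P₁ ↔ (p ∈ stacking L₁ s₀ σ₁ ∧ -(2 * R₀) ≤ p 2 ∧ p 2 ≤ -R₀ ∧ p 0 ^ 2 + p 1 ^ 2 ≤ ρ ^ 2))
    (hP₂ : ∀ p, p ∈ P₂ ↔ (p ∈ stacking L₂ s₂ σ₂ ∧ h + R₀ ≤ p 2 ∧ p 2 ≤ h + 2 * R₀ ∧ p 0 ^ 2 + p 1 ^ 2 ≤ ρ ^ 2))
    {F : EuclideanSpace ℝ (Fin 3) ≃ₗᵢ[ℝ] EuclideanSpace ℝ (Fin 3)} {v : EuclideanSpace ℝ (Fin 3)} (hv : v ∈ fccSlots) (hv2 : v 2 = 0)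
    (hrise : (3 / 4 : ℝ) ≤ (F v) 2) (hκ : κ ≤ (F v) 2)
    (hapart : F '' fccStacking 1 (Real.sqrt (2 / 3)) ≠ L₂ '' fccStacking 1 (Real.sqrt (2 / 3)) ∧
      F '' fccStacking 1 (Real.sqrt (2 / 3)) ≠
        (twinFrame L₂ (L₂ (EuclideanSpace.single (2 : Fin 3) (1 : ℝ)))) '' fccStacking 1 (Real.sqrt (2 / 3)))
    {y₀ : EuclideanSpace ℝ (Fin 3)} (hI : HRowInv X F v y₀)
    (hylo : -(2 * R₀) + 2 ≤ y₀ 2) (hyhi : y₀ 2 ≤ -R₀ - 2)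
    (hylat : Real.sqrt (y₀ 0 ^ 2 + y₀ 1 ^ 2) + 4 / 3 * (h + 4 * R₀) + 4 ≤ ρ)
    {N : ℕ} (hN : h + 4 * R₀ ≤ 3 / 4 * (N : ℝ)) :
    ∃ n : ℕ, n ≤ N ∧ hRowRun X F v N y₀ = y₀ + (n : ℝ) • F v ∧
      HRowInv X F v (hRowRun X F v N y₀) ∧ hRowStep X F v (hRowRun X F v N y₀) = none ∧
      hRowRun X F v N y₀ ∈ X.filter (fun y => (X.filter fun q => dist y q = 1).card ≠ 12 ∧ -R₀ - 2 ≤ y 2 ∧ y 2 ≤ h + R₀ + 2) ∧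
      (¬ WalkCertified12 X (hRowRun X F v N y₀) ⟨F, v, 0⟩ ∧
        ¬ WalkCertified12 X (hRowRun X F v N y₀) ⟨twinFrame F (F (EuclideanSpace.single (2 : Fin 3) (1 : ℝ))), v, 0⟩) ∧
      ∀ (F' : EuclideanSpace ℝ (Fin 3) ≃ₗᵢ[ℝ] EuclideanSpace ℝ (Fin 3)) (q : EuclideanSpace ℝ (Fin 3)), q ∈ fccSlots →
        (3 : ℝ) / 8 ≤ (F' q) 2 →
        F' '' fccStacking 1 (Real.sqrt (2 / 3)) ≠ F '' fccStacking 1 (Real.sqrt (2 / 3)) →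
        F' '' fccStacking 1 (Real.sqrt (2 / 3)) ≠
          (twinFrame F (F (EuclideanSpace.single (2 : Fin 3) (1 : ℝ)))) '' fccStacking 1 (Real.sqrt (2 / 3)) →
        ¬ WalkCertified12 X (hRowRun X F v N y₀) ⟨F', q, 0⟩ := by
  classical
  set e₃ : EuclideanSpace ℝ (Fin 3) := EuclideanSpace.single (2 : Fin 3) (1 : ℝ) with he₃
  have he₃n : ‖e₃‖ = 1 := by rw [he₃, PiLp.norm_single, norm_one]
  have he₃i : ∀ d : EuclideanSpace ℝ (Fin 3), ⟪d, e₃⟫_ℝ = d 2 := fun d => by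
    rw [he₃, EuclideanSpace.inner_single_right]; simp
  -- fuel in the three forms
  have hN' : h + 2 * R₀ - y₀ 2 < 3 / 4 * N := by linarith
  have hH : ∀ p ∈ X, ⟪p, e₃⟫_ℝ ≤ h + 2 * R₀ := fun p hp => by rw [he₃i]; exact (hcell p hp).2.1
  have hrise' : (3 / 4 : ℝ) ≤ ⟪F v, e₃⟫_ℝ := by rw [he₃i]; exact hrise
  have hNm : h + 2 * R₀ - ⟪y₀, e₃⟫_ℝ < 3 / 4 * (N : ℝ) := by rw [he₃i]; exact hN'
  -- the end
  obtain ⟨n, hn, hrun, hendX, hstop, hdeg⟩ := hRow_end_of_model hX hModel hv hv2 hrise' hH hI hNm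
  obtain ⟨n', -, hrun', hInv, -⟩ := hRowRun_spec (X := X) (F := F) hv hv2 N hI
  have hhigh := hRow_end_not_high hX hσ₂ L₂ s₂ R₀ h ρ hR₀ hh P₂ hP₂X hcell hP₂ hv hv2 hapart hrise
    (hStarCertifiedAt_of_model hModel F hv hv2) hI (by linarith) hylat hN'
  have hlow := hRow_end_not_low hX hσ₁ L₁ s₀ R₀ h ρ hR₀ hh P₁ hP₁X hcell hP₁ hv hv2 hrise
    (hStarCertifiedAt_of_model hModel F hv hv2) hI (by linarith) hylat hN'
  refine ⟨n, hn, hrun, hInv, hstop, ?_, not_walkCertified12_bottoms_of_hRowInv hX hv hv2 hInv, fun F' q hq hq' hA hB => ?_⟩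
  · rw [Finset.mem_filter]
    exact ⟨hendX, by omega, by linarith, by linarith⟩
  · have hsteep : κ ≤ ⟪F v, e₃⟫_ℝ := by rw [he₃i]; exact hκ
    have hq'' : (3 : ℝ) / 8 ≤ ⟪F' q, e₃⟫_ℝ := by rw [he₃i]; exact hq'
    exact HRowEndFarApart.not_certified12 hJ hX hv hv2 hq he₃n hsteep hq'' hA hB hInv hstop

/-- **h-ROW MEMBER, type A** (`σ₁ (k−1) = −1`, `σ₁ k = 1`; frame `L₁`, direction `u`).  The start `y₀ = L₁ (barlowPos σ₁ k a b) + s₀` in the launch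
band `[−2R₀+2, −R₀−2]`, laterally inside by `(4/3)(h+4R₀) + 5`; its row predecessor `barlowPos σ₁ k (a−α) (b−β)` is then deep inside plate 1.
Conclusion: the END `hRowRun X L₁ u N y₀ = y₀ + n·L₁u` lies in `PAY`, carries no certified bottom state `⟨L₁, u, 0⟩` / `⟨twinFrame L₁ (L₁ e₃), u, 0⟩`,
and (under `HRowEndFarApart κ`, `κ ≤ (L₁ u)₂`) no rising strongly certified state apart from `L₁·Λ₀` and its basal twin. -/
theorem hRow_member_A_apart (hX : ∀ p ∈ X, ∀ q ∈ X, p ≠ q → 1 ≤ dist p q) (hσ₁ : IsHaggSeq σ₁)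
    (hModel : HStarModel) {κ : ℝ} (hJ : HRowEndFarApart κ)
    {σ₂ : ℤ → ℤ} (hσ₂ : IsHaggSeq σ₂) (L₂ : EuclideanSpace ℝ (Fin 3) ≃ₗᵢ[ℝ] EuclideanSpace ℝ (Fin 3)) (s₂ : EuclideanSpace ℝ (Fin 3))
    (R₀ h ρ : ℝ) (hR₀ : 4 ≤ R₀) (hh : 0 ≤ h) (hρ : 1 ≤ ρ) (P₁ P₂ : Finset (EuclideanSpace ℝ (Fin 3))) (hP₁X : P₁ ⊆ X) (hP₂X : P₂ ⊆ X)
    (hcell : ∀ p ∈ X, -(2 * R₀) ≤ p 2 ∧ p 2 ≤ h + 2 * R₀ ∧ p 0 ^ 2 + p 1 ^ 2 ≤ ρ ^ 2)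
    (hP₁ : ∀ p, p ∈ P₁ ↔ (p ∈ stacking L₁ s₀ σ₁ ∧ -(2 * R₀) ≤ p 2 ∧ p 2 ≤ -R₀ ∧ p 0 ^ 2 + p 1 ^ 2 ≤ ρ ^ 2))
    (hP₂ : ∀ p, p ∈ P₂ ↔ (p ∈ stacking L₂ s₂ σ₂ ∧ h + R₀ ≤ p 2 ∧ p 2 ≤ h + 2 * R₀ ∧ p 0 ^ 2 + p 1 ^ 2 ≤ ρ ^ 2))
    {u : EuclideanSpace ℝ (Fin 3)} (hu : u ∈ fccSlots) (α β : ℤ) (huαβ : u = (α : ℝ) • triangularVec₁ 1 + (β : ℝ) • triangularVec₂ 1)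
    (hrise : (3 / 4 : ℝ) ≤ (L₁ u) 2) (hκ : κ ≤ (L₁ u) 2)
    (hapart : L₁ '' fccStacking 1 (Real.sqrt (2 / 3)) ≠ L₂ '' fccStacking 1 (Real.sqrt (2 / 3)) ∧
      L₁ '' fccStacking 1 (Real.sqrt (2 / 3)) ≠
        (twinFrame L₂ (L₂ (EuclideanSpace.single (2 : Fin 3) (1 : ℝ)))) '' fccStacking 1 (Real.sqrt (2 / 3)))
    (k a b : ℤ) (hk' : σ₁ (k - 1) = -1) (hk : σ₁ k = 1)
    (hylo : -(2 * R₀) + 2 ≤ (L₁ (barlowPos 1 (Real.sqrt (2 / 3)) σ₁ k a b) + s₀) 2)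
    (hyhi : (L₁ (barlowPos 1 (Real.sqrt (2 / 3)) σ₁ k a b) + s₀) 2 ≤ -R₀ - 2)
    (hylat : Real.sqrt ((L₁ (barlowPos 1 (Real.sqrt (2 / 3)) σ₁ k a b) + s₀) 0 ^ 2 +
      (L₁ (barlowPos 1 (Real.sqrt (2 / 3)) σ₁ k a b) + s₀) 1 ^ 2) + 4 / 3 * (h + 4 * R₀) + 5 ≤ ρ)
    {N : ℕ} (hN : h + 4 * R₀ ≤ 3 / 4 * (N : ℝ)) :
    ∃ n : ℕ, n ≤ N ∧
      hRowRun X L₁ u N (L₁ (barlowPos 1 (Real.sqrt (2 / 3)) σ₁ k a b) + s₀) =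
        L₁ (barlowPos 1 (Real.sqrt (2 / 3)) σ₁ k a b) + s₀ + (n : ℝ) • L₁ u ∧
      hRowRun X L₁ u N (L₁ (barlowPos 1 (Real.sqrt (2 / 3)) σ₁ k a b) + s₀) ∈
        X.filter (fun y => (X.filter fun q => dist y q = 1).card ≠ 12 ∧ -R₀ - 2 ≤ y 2 ∧ y 2 ≤ h + R₀ + 2) ∧
      (¬ WalkCertified12 X (hRowRun X L₁ u N (L₁ (barlowPos 1 (Real.sqrt (2 / 3)) σ₁ k a b) + s₀)) ⟨L₁, u, 0⟩ ∧
        ¬ WalkCertified12 X (hRowRun X L₁ u N (L₁ (barlowPos 1 (Real.sqrt (2 / 3)) σ₁ k a b) + s₀))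
          ⟨twinFrame L₁ (L₁ (EuclideanSpace.single (2 : Fin 3) (1 : ℝ))), u, 0⟩) ∧
      ∀ (F' : EuclideanSpace ℝ (Fin 3) ≃ₗᵢ[ℝ] EuclideanSpace ℝ (Fin 3)) (q : EuclideanSpace ℝ (Fin 3)), q ∈ fccSlots →
        (3 : ℝ) / 8 ≤ (F' q) 2 →
        F' '' fccStacking 1 (Real.sqrt (2 / 3)) ≠ L₁ '' fccStacking 1 (Real.sqrt (2 / 3)) →
        F' '' fccStacking 1 (Real.sqrt (2 / 3)) ≠
          (twinFrame L₁ (L₁ (EuclideanSpace.single (2 : Fin 3) (1 : ℝ)))) '' fccStacking 1 (Real.sqrt (2 / 3)) →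
          ¬ WalkCertified12 X (hRowRun X L₁ u N (L₁ (barlowPos 1 (Real.sqrt (2 / 3)) σ₁ k a b) + s₀)) ⟨F', q, 0⟩ := by
  classical
  have hu2 : u 2 = 0 := by
    rw [huαβ]
    obtain ⟨-, -, h12, -, -, h22⟩ := Summit.Ventures.Crystal3D.Cruxes.TextureLiminf.TexShadow.triangularVec_coords
    simp [h12, h22]
  have hLu1 : ‖L₁ u‖ = 1 := by rw [LinearIsometryEquiv.norm_map, norm_eq_one_of_mem_fccSlots hu]
  have hLu2 : (L₁ u) 2 ≤ 1 := by
    have h1 := abs_apply_sub_le_dist (L₁ u) 0 2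
    rw [dist_zero_right, hLu1] at h1
    have : (0 : EuclideanSpace ℝ (Fin 3)) 2 = 0 := rfl
    rw [this, sub_zero] at h1
    exact (abs_le.1 h1).2
  -- the predecessor site and the start
  set p₀ := barlowPos 1 (Real.sqrt (2 / 3)) σ₁ k (a - α) (b - β) with hp₀
  have hp₀u : p₀ + u = barlowPos 1 (Real.sqrt (2 / 3)) σ₁ k a b := by
    rw [hp₀, huαβ, barlowPos_add_inplane, sub_add_cancel, sub_add_cancel]
  have hy₀ : L₁ (barlowPos 1 (Real.sqrt (2 / 3)) σ₁ k a b) + s₀ = L₁ p₀ + s₀ + L₁ u := by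
    rw [← hp₀u, map_add]; abel
  -- the predecessor is deep inside plate 1: heights and lateral radius
  have hp2 : (L₁ p₀ + s₀) 2 = (L₁ (barlowPos 1 (Real.sqrt (2 / 3)) σ₁ k a b) + s₀) 2 - (L₁ u) 2 := by
    rw [hy₀]; simp
  have hplat : Real.sqrt ((L₁ p₀ + s₀) 0 ^ 2 + (L₁ p₀ + s₀) 1 ^ 2) ≤
      Real.sqrt ((L₁ (barlowPos 1 (Real.sqrt (2 / 3)) σ₁ k a b) + s₀) 0 ^ 2 +
        (L₁ (barlowPos 1 (Real.sqrt (2 / 3)) σ₁ k a b) + s₀) 1 ^ 2) + 1 := by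
    have h1 := sqrt_lateral_add_le (L₁ (barlowPos 1 (Real.sqrt (2 / 3)) σ₁ k a b) + s₀) (-(L₁ u))
    have e : L₁ (barlowPos 1 (Real.sqrt (2 / 3)) σ₁ k a b) + s₀ + -L₁ u = L₁ p₀ + s₀ := by rw [hy₀]; abel
    rw [e, norm_neg, hLu1] at h1
    exact h1
  have hcomp : ∀ q ∈ barlowStacking 1 (Real.sqrt (2 / 3)) σ₁, dist q p₀ ≤ 1 → L₁ q + s₀ ∈ X := by
    refine barlowWindow_complete L₁ s₀ R₀ ρ hρ P₁ hP₁X hP₁ k (a - α) (b - β) (by rw [hp2]; linarith) (by rw [hp2]; linarith) ?_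
    have h0 : 0 ≤ (L₁ p₀ + s₀) 0 ^ 2 + (L₁ p₀ + s₀) 1 ^ 2 := by positivity
    have hrr : Real.sqrt ((L₁ p₀ + s₀) 0 ^ 2 + (L₁ p₀ + s₀) 1 ^ 2) ≤ ρ - 1 := by
      have : 0 ≤ 4 / 3 * (h + 4 * R₀) := by positivity
      linarith
    have hρ1 : 0 ≤ ρ - 1 := by linarith
    have h7 := pow_le_pow_left₀ (Real.sqrt_nonneg _) hrr 2
    rwa [Real.sq_sqrt h0] at h7
  -- the invariant at the start
  have hI : HRowInv X L₁ u (L₁ (barlowPos 1 (Real.sqrt (2 / 3)) σ₁ k a b) + s₀) := by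
    rw [hy₀]; exact hRowInv_start_barlow_A σ₁ L₁ s₀ k (a - α) (b - β) hk' hk hcomp hu hu2
  obtain ⟨n, hn, hrun, -, -, hPAY, hbot, hfar⟩ := hRow_member_core_apart σ₁ L₁ s₀ hX hσ₁ hModel hJ hσ₂ L₂ s₂ R₀ h ρ hR₀ hh P₁ P₂
    hP₁X hP₂X hcell hP₁ hP₂ hu hu2 hrise hκ hapart hI hylo hyhi (by linarith) hN
  exact ⟨n, hn, hrun, hPAY, hbot, hfar⟩

/-- **h-ROW MEMBER, type B** (`σ₁ (k−1) = 1`, `σ₁ k = −1`; frame `neg ≫ L₁`, direction `−u`, physical direction `L₁ u`).  Same hypotheses and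
conclusion as type A (read back in the c-grains' presentation `(L₁, u)` via `walkCertified12_negTrans_iff`), the END being
`hRowRun X (neg ≫ L₁) (−u) N y₀ = y₀ + n·L₁u`. -/
theorem hRow_member_B_apart (hX : ∀ p ∈ X, ∀ q ∈ X, p ≠ q → 1 ≤ dist p q) (hσ₁ : IsHaggSeq σ₁)
    (hModel : HStarModel) {κ : ℝ} (hJ : HRowEndFarApart κ)
    {σ₂ : ℤ → ℤ} (hσ₂ : IsHaggSeq σ₂) (L₂ : EuclideanSpace ℝ (Fin 3) ≃ₗᵢ[ℝ] EuclideanSpace ℝ (Fin 3)) (s₂ : EuclideanSpace ℝ (Fin 3))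
    (R₀ h ρ : ℝ) (hR₀ : 4 ≤ R₀) (hh : 0 ≤ h) (hρ : 1 ≤ ρ) (P₁ P₂ : Finset (EuclideanSpace ℝ (Fin 3))) (hP₁X : P₁ ⊆ X) (hP₂X : P₂ ⊆ X)
    (hcell : ∀ p ∈ X, -(2 * R₀) ≤ p 2 ∧ p 2 ≤ h + 2 * R₀ ∧ p 0 ^ 2 + p 1 ^ 2 ≤ ρ ^ 2)
    (hP₁ : ∀ p, p ∈ P₁ ↔ (p ∈ stacking L₁ s₀ σ₁ ∧ -(2 * R₀) ≤ p 2 ∧ p 2 ≤ -R₀ ∧ p 0 ^ 2 + p 1 ^ 2 ≤ ρ ^ 2))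
    (hP₂ : ∀ p, p ∈ P₂ ↔ (p ∈ stacking L₂ s₂ σ₂ ∧ h + R₀ ≤ p 2 ∧ p 2 ≤ h + 2 * R₀ ∧ p 0 ^ 2 + p 1 ^ 2 ≤ ρ ^ 2))
    {u : EuclideanSpace ℝ (Fin 3)} (hu : u ∈ fccSlots) (α β : ℤ) (huαβ : u = (α : ℝ) • triangularVec₁ 1 + (β : ℝ) • triangularVec₂ 1)
    (hrise : (3 / 4 : ℝ) ≤ (L₁ u) 2) (hκ : κ ≤ (L₁ u) 2)
    (hapart : L₁ '' fccStacking 1 (Real.sqrt (2 / 3)) ≠ L₂ '' fccStacking 1 (Real.sqrt (2 / 3)) ∧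
      L₁ '' fccStacking 1 (Real.sqrt (2 / 3)) ≠
        (twinFrame L₂ (L₂ (EuclideanSpace.single (2 : Fin 3) (1 : ℝ)))) '' fccStacking 1 (Real.sqrt (2 / 3)))
    (k a b : ℤ) (hk' : σ₁ (k - 1) = 1) (hk : σ₁ k = -1)
    (hylo : -(2 * R₀) + 2 ≤ (L₁ (barlowPos 1 (Real.sqrt (2 / 3)) σ₁ k a b) + s₀) 2)
    (hyhi : (L₁ (barlowPos 1 (Real.sqrt (2 / 3)) σ₁ k a b) + s₀) 2 ≤ -R₀ - 2)
    (hylat : Real.sqrt ((L₁ (barlowPos 1 (Real.sqrt (2 / 3)) σ₁ k a b) + s₀) 0 ^ 2 +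
      (L₁ (barlowPos 1 (Real.sqrt (2 / 3)) σ₁ k a b) + s₀) 1 ^ 2) + 4 / 3 * (h + 4 * R₀) + 5 ≤ ρ)
    {N : ℕ} (hN : h + 4 * R₀ ≤ 3 / 4 * (N : ℝ)) :
    ∃ n : ℕ, n ≤ N ∧
      hRowRun X ((LinearIsometryEquiv.neg ℝ).trans L₁) (-u) N (L₁ (barlowPos 1 (Real.sqrt (2 / 3)) σ₁ k a b) + s₀) =
        L₁ (barlowPos 1 (Real.sqrt (2 / 3)) σ₁ k a b) + s₀ + (n : ℝ) • L₁ u ∧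
      hRowRun X ((LinearIsometryEquiv.neg ℝ).trans L₁) (-u) N (L₁ (barlowPos 1 (Real.sqrt (2 / 3)) σ₁ k a b) + s₀) ∈
        X.filter (fun y => (X.filter fun q => dist y q = 1).card ≠ 12 ∧ -R₀ - 2 ≤ y 2 ∧ y 2 ≤ h + R₀ + 2) ∧
      (¬ WalkCertified12 X
          (hRowRun X ((LinearIsometryEquiv.neg ℝ).trans L₁) (-u) N (L₁ (barlowPos 1 (Real.sqrt (2 / 3)) σ₁ k a b) + s₀)) ⟨L₁, u, 0⟩ ∧
        ¬ WalkCertified12 X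
          (hRowRun X ((LinearIsometryEquiv.neg ℝ).trans L₁) (-u) N (L₁ (barlowPos 1 (Real.sqrt (2 / 3)) σ₁ k a b) + s₀))
          ⟨twinFrame L₁ (L₁ (EuclideanSpace.single (2 : Fin 3) (1 : ℝ))), u, 0⟩) ∧
      ∀ (F' : EuclideanSpace ℝ (Fin 3) ≃ₗᵢ[ℝ] EuclideanSpace ℝ (Fin 3)) (q : EuclideanSpace ℝ (Fin 3)), q ∈ fccSlots →
        (3 : ℝ) / 8 ≤ (F' q) 2 →
        F' '' fccStacking 1 (Real.sqrt (2 / 3)) ≠ L₁ '' fccStacking 1 (Real.sqrt (2 / 3)) →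
        F' '' fccStacking 1 (Real.sqrt (2 / 3)) ≠
          (twinFrame L₁ (L₁ (EuclideanSpace.single (2 : Fin 3) (1 : ℝ)))) '' fccStacking 1 (Real.sqrt (2 / 3)) →
          ¬ WalkCertified12 X
            (hRowRun X ((LinearIsometryEquiv.neg ℝ).trans L₁) (-u) N (L₁ (barlowPos 1 (Real.sqrt (2 / 3)) σ₁ k a b) + s₀)) ⟨F', q, 0⟩ := by
  classical
  set F : EuclideanSpace ℝ (Fin 3) ≃ₗᵢ[ℝ] EuclideanSpace ℝ (Fin 3) := (LinearIsometryEquiv.neg ℝ).trans L₁ with hFdef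
  have hF : ∀ x : EuclideanSpace ℝ (Fin 3), F x = L₁ (-x) := fun x => rfl
  have hFu : F (-u) = L₁ u := by rw [hF, neg_neg]
  have hu2 : u 2 = 0 := by
    rw [huαβ]
    obtain ⟨-, -, h12, -, -, h22⟩ := Summit.Ventures.Crystal3D.Cruxes.TextureLiminf.TexShadow.triangularVec_coords
    simp [h12, h22]
  have hnu : -u ∈ fccSlots := neg_mem_fccSlots hu
  have hnu2 : (-u) 2 = 0 := by rw [PiLp.neg_apply, hu2, neg_zero]
  have hLu1 : ‖L₁ u‖ = 1 := by rw [LinearIsometryEquiv.norm_map, norm_eq_one_of_mem_fccSlots hu]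
  have hLu2 : (L₁ u) 2 ≤ 1 := by
    have h1 := abs_apply_sub_le_dist (L₁ u) 0 2
    rw [dist_zero_right, hLu1] at h1
    have : (0 : EuclideanSpace ℝ (Fin 3)) 2 = 0 := rfl
    rw [this, sub_zero] at h1
    exact (abs_le.1 h1).2
  have hriseF : (3 / 4 : ℝ) ≤ (F (-u)) 2 := by rw [hFu]; exact hrise
  have hapartF : F '' fccStacking 1 (Real.sqrt (2 / 3)) ≠ L₂ '' fccStacking 1 (Real.sqrt (2 / 3)) ∧
      F '' fccStacking 1 (Real.sqrt (2 / 3)) ≠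
        (twinFrame L₂ (L₂ (EuclideanSpace.single (2 : Fin 3) (1 : ℝ)))) '' fccStacking 1 (Real.sqrt (2 / 3)) := by
    rw [hFdef, image_negTrans_fcc]; exact hapart
  -- the predecessor site and the start
  set p₀ := barlowPos 1 (Real.sqrt (2 / 3)) σ₁ k (a - α) (b - β) with hp₀
  have hp₀u : p₀ + u = barlowPos 1 (Real.sqrt (2 / 3)) σ₁ k a b := by
    rw [hp₀, huαβ, barlowPos_add_inplane, sub_add_cancel, sub_add_cancel]
  have hy₀ : L₁ (barlowPos 1 (Real.sqrt (2 / 3)) σ₁ k a b) + s₀ = L₁ p₀ + s₀ + L₁ u := by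
    rw [← hp₀u, map_add]; abel
  have hp2 : (L₁ p₀ + s₀) 2 = (L₁ (barlowPos 1 (Real.sqrt (2 / 3)) σ₁ k a b) + s₀) 2 - (L₁ u) 2 := by
    rw [hy₀]; simp
  have hplat : Real.sqrt ((L₁ p₀ + s₀) 0 ^ 2 + (L₁ p₀ + s₀) 1 ^ 2) ≤
      Real.sqrt ((L₁ (barlowPos 1 (Real.sqrt (2 / 3)) σ₁ k a b) + s₀) 0 ^ 2 +
        (L₁ (barlowPos 1 (Real.sqrt (2 / 3)) σ₁ k a b) + s₀) 1 ^ 2) + 1 := by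
    have h1 := sqrt_lateral_add_le (L₁ (barlowPos 1 (Real.sqrt (2 / 3)) σ₁ k a b) + s₀) (-(L₁ u))
    have e : L₁ (barlowPos 1 (Real.sqrt (2 / 3)) σ₁ k a b) + s₀ + -L₁ u = L₁ p₀ + s₀ := by rw [hy₀]; abel
    rw [e, norm_neg, hLu1] at h1
    exact h1
  have hcomp : ∀ q ∈ barlowStacking 1 (Real.sqrt (2 / 3)) σ₁, dist q p₀ ≤ 1 → L₁ q + s₀ ∈ X := by
    refine barlowWindow_complete L₁ s₀ R₀ ρ hρ P₁ hP₁X hP₁ k (a - α) (b - β) (by rw [hp2]; linarith) (by rw [hp2]; linarith) ?_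
    have h0 : 0 ≤ (L₁ p₀ + s₀) 0 ^ 2 + (L₁ p₀ + s₀) 1 ^ 2 := by positivity
    have hrr : Real.sqrt ((L₁ p₀ + s₀) 0 ^ 2 + (L₁ p₀ + s₀) 1 ^ 2) ≤ ρ - 1 := by
      have : 0 ≤ 4 / 3 * (h + 4 * R₀) := by positivity
      linarith
    have hρ1 : 0 ≤ ρ - 1 := by linarith
    have h7 := pow_le_pow_left₀ (Real.sqrt_nonneg _) hrr 2
    rwa [Real.sq_sqrt h0] at h7
  -- the invariant at the start (type B: the dozen is `p₀ − hcpSlots = p₀ + F·hcpSlots`)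
  have hI : HRowInv X F (-u) (L₁ (barlowPos 1 (Real.sqrt (2 / 3)) σ₁ k a b) + s₀) := by
    have h := hRowInv_start_barlow_B σ₁ L₁ s₀ k (a - α) (b - β) hk' hk hcomp hnu hnu2
    rw [neg_neg] at h
    rw [hy₀]; exact h
  have hκF : κ ≤ (F (-u)) 2 := by rw [hFu]; exact hκ
  obtain ⟨n, hn, hrun, -, -, hPAY, hbot, hfar⟩ := hRow_member_core_apart σ₁ L₁ s₀ hX hσ₁ hModel hJ hσ₂ L₂ s₂ R₀ h ρ hR₀ hh P₁ P₂
    hP₁X hP₂X hcell hP₁ hP₂ hnu hnu2 hriseF hκF hapartF hI hylo hyhi (by linarith) hN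
  -- convert the type-B presentation `(neg ≫ L₁, −u)` to the c-grains' bottoms `(L₁, u)`, `(twinFrame L₁ (L₁ e₃), u)`
  have hFΛ : F '' fccStacking 1 (Real.sqrt (2 / 3)) = L₁ '' fccStacking 1 (Real.sqrt (2 / 3)) := by rw [hFdef, image_negTrans_fcc]
  have hFtw : twinFrame F (F (EuclideanSpace.single (2 : Fin 3) (1 : ℝ))) =
      (LinearIsometryEquiv.neg ℝ).trans (twinFrame L₁ (L₁ (EuclideanSpace.single (2 : Fin 3) (1 : ℝ)))) := by
    rw [hFdef]; exact twinFrame_negTrans_axis L₁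
  have hFtwΛ : (twinFrame F (F (EuclideanSpace.single (2 : Fin 3) (1 : ℝ)))) '' fccStacking 1 (Real.sqrt (2 / 3)) =
      (twinFrame L₁ (L₁ (EuclideanSpace.single (2 : Fin 3) (1 : ℝ)))) '' fccStacking 1 (Real.sqrt (2 / 3)) := by
    rw [hFtw, image_negTrans_fcc]
  refine ⟨n, hn, ?_, hPAY, ⟨fun hC => hbot.1 ?_, fun hC => hbot.2 ?_⟩, fun F' q hq hq' hA hB => hfar F' q hq hq' ?_ ?_⟩
  · rw [hrun, hFu]
  · rw [hFdef]; exact (walkCertified12_negTrans_iff X L₁ u _).2 hC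
  · rw [hFtw]; exact (walkCertified12_negTrans_iff X _ u _).2 hC
  · rw [hFΛ]; exact hA
  · rw [hFtwΛ]; exact hB

end Cell

end Summit.Ventures.Crystal3D.Theorems

end
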